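import Literature.Topology.FourManifolds.AmbientSmoothExtension

/-!
# Ambient presentation of seam maps, for stub `stub_seamDiffeos` of line `lp-by-sphere-system-surgery`
(crux `AgkCor6Sufficiency`, item stmt-SmoothPoincare4-10894, routes CongruenceShadows /
GroupTrisection; lead reshape r5, B2)

Milnor-smooth maps on the seams `H_m = hd(H)` of a trisection extend to smooth maps of open
neighbourhoods.  Registered helper stub `stub_seamDiffeosExtendToolkit : SeamDiffeosExtendToolkit`:

* `exists_local_extension_interior` — near the image of an INTERIOR point of a smoothly embedded
  `3`-manifold with boundary `h₁ : M → X⁴`, a smooth `G : M → Y` is `Ψ ∘ h₁` for a smooth `Ψ`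
  of an open set of `X` (slice charts of the immersion `h₁`, exactly as in the tree's
  `exists_local_ambient_extension` for boundary points, without the flattening);
* `exists_seam_extension` — gluing (`exists_ambient_extension_of_local`: Whitney embedding,
  normal retraction, partition of unity): if moreover `G` is presented near the image of `∂M`
  by a smooth map of an open set, then `G = Ψs ∘ h₁` for ONE smooth `Ψs` of an open
  neighbourhood of `range h₁`.

References: Milnor, *Topology from the differentiable viewpoint* (1965), §1 (smooth maps on
subsets); Hirsch, *Differential Topology* (1976), Ch. 4 §5, Thm. 5.1–5.2; Abrams–Gay–Kirby,
Geom. Topol. 22 (2018), proof of Thm. 5.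
-/

noncomputable section

-- the prescribed namespace `Summit.<P>.<Sub>.…` duplicates `SmoothPoincare4` (P = Sub)
set_option linter.dupNamespace false

namespace Summit.SmoothPoincare4.SmoothPoincare4.Cruxes.AgkCor6Sufficiency.LpBySphereSystemSurgery

open Set Function Filter
open scoped _root_.Manifold _root_.ContDiff _root_.Topology
open Literature.Topology.FourManifolds

/-! ## Local ambient extension at interior points, and gluing -/

section Extension

variable {M : Type*} [TopologicalSpace M] [ChartedSpace (EuclideanHalfSpace 3) M]
  [IsManifold (𝓡∂ 3) ∞ M]
  {X : Type*} [TopologicalSpace X] [ChartedSpace (EuclideanSpace ℝ (Fin 4)) X]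
  {Y : Type*} [TopologicalSpace Y] [ChartedSpace (EuclideanSpace ℝ (Fin 4)) Y]

/-- **Local ambient extension at an interior point of a smoothly embedded `3`-manifold with
boundary.**  For a smooth embedding `h₁ : M → X` into a `4`-manifold, a smooth `G : M → Y` and
an interior point `z` of `M`, near `h₁ z` there is a smooth `Ψ` of an open set of `X` with
`Ψ (h₁ z') = G z'`: in the slice charts `(φ, χ, L)` of the immersion `h₁` at `z`
(`χ ∘ h₁ ∘ φ⁻¹ = L ∘ (·, 0)`), `Ψ = G ∘ φ⁻¹ ∘ pr₁ ∘ L⁻¹ ∘ χ` on the open set where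
`pr₁ ∘ L⁻¹ ∘ χ` lands in the open half of `φ`'s target (interior point: `(φ z)₀ > 0` by the
invariance of the boundary).  (Milnor's smooth maps on subsets; cf.
`exists_local_ambient_extension` for boundary points.) -/
theorem exists_local_extension_interior [IsManifold (𝓡 4) ∞ X] {h₁ : M → X}
    (hh₁ : Manifold.IsSmoothEmbedding (𝓡∂ 3) (𝓡 4) ∞ h₁)
    {G : M → Y} (hG : ContMDiff (𝓡∂ 3) (𝓡 4) ∞ G) {z : M} (hz : z ∉ (𝓡∂ 3).boundary M) :
    ∃ V : Set X, IsOpen V ∧ h₁ z ∈ V ∧ ∃ Ψ : X → Y, ContMDiffOn (𝓡 4) (𝓡 4) ∞ Ψ V ∧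
      ∀ z', h₁ z' ∈ V → Ψ (h₁ z') = G z' := by
  obtain ⟨C, _, _, hC⟩ := hh₁.isImmersion
  have hm := hC z
  -- an open `U₁ ⊆ X` cutting `hm.domChart.source` out of `M`
  obtain ⟨U₁, hU₁, hU₁eq⟩ := hh₁.isEmbedding.isInducing.isOpen_iff.1 hm.domChart.open_source
  -- the coordinate map `q = pr₁ ∘ L⁻¹ ∘ χ`
  set q : X → EuclideanSpace ℝ (Fin 3) :=
    fun x => (hm.equiv.symm (hm.codChart.extend (𝓡 4) x)).1 with hq
  have hqs : ContMDiffOn (𝓡 4) 𝓘(ℝ, EuclideanSpace ℝ (Fin 3)) ∞ q hm.codChart.source := by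
    have h1 : ContMDiffOn (𝓡 4) 𝓘(ℝ, EuclideanSpace ℝ (Fin 4)) ∞ (hm.codChart.extend (𝓡 4))
        hm.codChart.source :=
      hm.codChart.contMDiffOn_extend hm.codChart_mem_maximalAtlas
    have h2 : ContMDiff 𝓘(ℝ, EuclideanSpace ℝ (Fin 4)) 𝓘(ℝ, EuclideanSpace ℝ (Fin 3)) ∞
        (fun w => (hm.equiv.symm w).1) := by
      rw [contMDiff_iff_contDiff]
      exact contDiff_fst.comp hm.equiv.symm.contDiff
    exact h2.comp_contMDiffOn h1
  -- on `h₁ (hm.domChart.source)` the map `q` is the chart `φ`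
  have key : ∀ w ∈ hm.domChart.source, q (h₁ w) = hm.domChart.extend (𝓡∂ 3) w ∧
      hm.domChart.extend (𝓡∂ 3) w ∈ (hm.domChart.extend (𝓡∂ 3)).target := by
    intro w hw
    have hws : w ∈ (hm.domChart.extend (𝓡∂ 3)).source := by
      rwa [OpenPartialHomeomorph.extend_source]
    have hu : hm.domChart.extend (𝓡∂ 3) w ∈ (hm.domChart.extend (𝓡∂ 3)).target :=
      (hm.domChart.extend (𝓡∂ 3)).map_source hws
    refine ⟨?_, hu⟩
    have hwr := hm.writtenInCharts hu
    simp only [comp_apply, (hm.domChart.extend (𝓡∂ 3)).left_inv hws] at hwr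
    show (hm.equiv.symm (hm.codChart.extend (𝓡 4) (h₁ w))).1 = _
    rw [hwr, ContinuousLinearEquiv.symm_apply_apply]
  -- `z` is an interior point: `(φ z)₀ > 0`
  have hz0 : 0 < hm.domChart.extend (𝓡∂ 3) z 0 := by
    have hnot : hm.domChart.extend (𝓡∂ 3) z ∉ frontier (range (𝓡∂ 3)) := fun hfr =>
      hz ((isBoundaryPoint_iff_of_mem_maximalAtlas (I := 𝓡∂ 3) (m := ∞) (by simp)
        hm.domChart_mem_maximalAtlas hm.mem_domChart_source).2 hfr)
    rw [mem_frontier_range_iff] at hnot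
    have hge : 0 ≤ hm.domChart.extend (𝓡∂ 3) z 0 := by
      have hr : hm.domChart.extend (𝓡∂ 3) z ∈ range (𝓡∂ 3) := by simp
      rw [range_modelWithCornersEuclideanHalfSpace] at hr
      exact hr
    exact lt_of_le_of_ne hge (Ne.symm hnot)
  -- the open set
  set B : Set (EuclideanSpace ℝ (Fin 3)) :=
    (𝓡∂ 3).symm ⁻¹' hm.domChart.target ∩ {w | 0 < w 0} with hB
  have hBo : IsOpen B :=
    (hm.domChart.open_target.preimage (𝓡∂ 3).continuous_symm).inter
      (isOpen_lt continuous_const (EuclideanSpace.proj (0 : Fin 3)).continuous)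
  have hBt : ∀ w ∈ B, w ∈ (hm.domChart.extend (𝓡∂ 3)).target := by
    intro w hw
    rw [OpenPartialHomeomorph.extend_target]
    refine ⟨hw.1, ?_⟩
    rw [range_modelWithCornersEuclideanHalfSpace]
    have h2 : 0 < w 0 := hw.2
    exact h2.le
  refine ⟨U₁ ∩ (hm.codChart.source ∩ q ⁻¹' B), ?_, ?_, ?_⟩
  · exact hU₁.inter (hqs.continuousOn.isOpen_inter_preimage hm.codChart.open_source hBo)
  · have hzs : z ∈ hm.domChart.source := hm.mem_domChart_source
    refine ⟨?_, hm.mem_codChart_source, ?_⟩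
    · show z ∈ h₁ ⁻¹' U₁
      rw [hU₁eq]
      exact hzs
    · obtain ⟨hq', hu⟩ := key z hzs
      show q (h₁ z) ∈ B
      rw [hq']
      rw [OpenPartialHomeomorph.extend_target] at hu
      exact ⟨hu.1, hz0⟩
  refine ⟨fun x => G ((hm.domChart.extend (𝓡∂ 3)).symm (q x)), ?_, ?_⟩
  · have hmaps : MapsTo q (U₁ ∩ (hm.codChart.source ∩ q ⁻¹' B)) ((𝓡∂ 3) '' hm.domChart.target) := by
      rintro x ⟨-, -, hx⟩
      refine ⟨(𝓡∂ 3).symm (q x), hx.1, (𝓡∂ 3).right_inv ?_⟩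
      rw [range_modelWithCornersEuclideanHalfSpace]
      have h2 : 0 < q x 0 := hx.2
      exact h2.le
    have h1 : ContMDiffOn (𝓡 4) (𝓡∂ 3) ∞ (fun x => (hm.domChart.extend (𝓡∂ 3)).symm (q x))
        (U₁ ∩ (hm.codChart.source ∩ q ⁻¹' B)) :=
      (contMDiffOn_extend_symm hm.domChart_mem_maximalAtlas).comp
        (hqs.mono fun x hx => hx.2.1) hmaps
    exact hG.comp_contMDiffOn h1
  · rintro z' ⟨hz'U, -, -⟩
    have hz's : z' ∈ hm.domChart.source := by
      rw [← hU₁eq]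
      exact hz'U
    obtain ⟨hq', -⟩ := key z' hz's
    have hws : z' ∈ (hm.domChart.extend (𝓡∂ 3)).source := by
      rwa [OpenPartialHomeomorph.extend_source]
    show G ((hm.domChart.extend (𝓡∂ 3)).symm (q (h₁ z'))) = G z'
    rw [hq', (hm.domChart.extend (𝓡∂ 3)).left_inv hws]

/-- **One smooth ambient map presenting `G` along the whole seam** (gluing,
`exists_ambient_extension_of_local`): if `h₁ : M → X` is a smooth embedding of a compact
`3`-manifold with boundary into a closed `4`-manifold, `G : M → Y` is smooth (`Y` a closed
`4`-manifold), and near the image of the boundary `G` is already presented by a smooth map `P`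
of an open `T ∋ h₁(∂M)` (`G z = P (h₁ z)` whenever `h₁ z ∈ T`), then `G = Ψs ∘ h₁` for a smooth
`Ψs` of an open `W ⊇ range h₁` (interior points: `exists_local_extension_interior`). -/
theorem exists_seam_extension [T2Space X] [CompactSpace X] [IsManifold (𝓡 4) ∞ X]
    [T2Space Y] [CompactSpace Y] [Nonempty Y] [IsManifold (𝓡 4) ∞ Y] [CompactSpace M]
    {h₁ : M → X} (hh₁ : Manifold.IsSmoothEmbedding (𝓡∂ 3) (𝓡 4) ∞ h₁)
    {G : M → Y} (hG : ContMDiff (𝓡∂ 3) (𝓡 4) ∞ G) {T : Set X} (hT : IsOpen T)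
    (hbT : ∀ z ∈ (𝓡∂ 3).boundary M, h₁ z ∈ T) {P : X → Y} (hP : ContMDiffOn (𝓡 4) (𝓡 4) ∞ P T)
    (hGP : ∀ z, h₁ z ∈ T → G z = P (h₁ z)) :
    ∃ (W : Set X) (Ψs : X → Y), IsOpen W ∧ range h₁ ⊆ W ∧ ContMDiffOn (𝓡 4) (𝓡 4) ∞ Ψs W ∧
      ∀ z, Ψs (h₁ z) = G z := by
  have hinj : Injective h₁ := hh₁.isEmbedding.injective
  have hK : IsClosed (range h₁) := (isCompact_range hh₁.isEmbedding.continuous).isClosed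
  set f : ↥(range h₁) → Y := fun y => G y.2.choose with hf
  have hfG : ∀ z, f ⟨h₁ z, mem_range_self z⟩ = G z := fun z =>
    congrArg G (hinj (mem_range_self (f := h₁) z).choose_spec)
  have hloc : ∀ x ∈ range h₁, ∃ V : Set X, IsOpen V ∧ x ∈ V ∧ ∃ Ψ : X → Y,
      ContMDiffOn (𝓡 4) (𝓡 4) ∞ Ψ V ∧ ∀ (y : X) (hy : y ∈ range h₁), y ∈ V → Ψ y = f ⟨y, hy⟩ := by
    rintro x ⟨z, rfl⟩
    by_cases hzT : h₁ z ∈ T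
    · refine ⟨T, hT, hzT, P, hP, ?_⟩
      rintro y ⟨z', rfl⟩ hyT
      rw [hfG, hGP z' hyT]
    · have hzb : z ∉ (𝓡∂ 3).boundary M := fun hzb => hzT (hbT z hzb)
      obtain ⟨V, hVo, hzV, Ψ, hΨ, hΨG⟩ := exists_local_extension_interior hh₁ hG hzb
      refine ⟨V, hVo, hzV, Ψ, hΨ, ?_⟩
      rintro y ⟨z', rfl⟩ hyV
      rw [hfG, hΨG z' hyV]
  obtain ⟨W, Ψs, hWo, hKW, hΨs, hΨsf⟩ := exists_ambient_extension_of_local hK f hloc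
  exact ⟨W, Ψs, hWo, hKW, hΨs, fun z => (hΨsf ⟨h₁ z, mem_range_self z⟩).trans (hfG z)⟩

end Extension

/-! ## The registered helper stub -/

/-- **Toolkit of the seam diffeomorphisms, ambient presentation** (registered helper stub of
`stub_seamDiffeos`): (1) local ambient extension at interior points of a smoothly embedded
`3`-manifold with boundary; (2) one ambient smooth map presenting a smooth map of a compact
`3`-manifold along its whole embedded image.  (A conjunction of statements PROVED in this file,
not a named fact.) -/
def SeamDiffeosExtendToolkit : Prop :=
  (∀ (M : Type) [TopologicalSpace M] [ChartedSpace (EuclideanHalfSpace 3) M] [IsManifold (𝓡∂ 3) ∞ M]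
    (X : Type) [TopologicalSpace X] [ChartedSpace (EuclideanSpace ℝ (Fin 4)) X] [IsManifold (𝓡 4) ∞ X]
    (Y : Type) [TopologicalSpace Y] [ChartedSpace (EuclideanSpace ℝ (Fin 4)) Y]
    (h₁ : M → X), Manifold.IsSmoothEmbedding (𝓡∂ 3) (𝓡 4) ∞ h₁ →
    ∀ (G : M → Y), ContMDiff (𝓡∂ 3) (𝓡 4) ∞ G → ∀ z : M, z ∉ (𝓡∂ 3).boundary M →
    ∃ V : Set X, IsOpen V ∧ h₁ z ∈ V ∧ ∃ Ψ : X → Y, ContMDiffOn (𝓡 4) (𝓡 4) ∞ Ψ V ∧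
      ∀ z', h₁ z' ∈ V → Ψ (h₁ z') = G z') ∧
  (∀ (M : Type) [TopologicalSpace M] [ChartedSpace (EuclideanHalfSpace 3) M] [IsManifold (𝓡∂ 3) ∞ M]
    [CompactSpace M]
    (X : Type) [TopologicalSpace X] [T2Space X] [CompactSpace X]
    [ChartedSpace (EuclideanSpace ℝ (Fin 4)) X] [IsManifold (𝓡 4) ∞ X]
    (Y : Type) [TopologicalSpace Y] [T2Space Y] [CompactSpace Y] [Nonempty Y]
    [ChartedSpace (EuclideanSpace ℝ (Fin 4)) Y] [IsManifold (𝓡 4) ∞ Y]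
    (h₁ : M → X), Manifold.IsSmoothEmbedding (𝓡∂ 3) (𝓡 4) ∞ h₁ →
    ∀ (G : M → Y), ContMDiff (𝓡∂ 3) (𝓡 4) ∞ G → ∀ (T : Set X), IsOpen T →
    (∀ z ∈ (𝓡∂ 3).boundary M, h₁ z ∈ T) → ∀ (P : X → Y), ContMDiffOn (𝓡 4) (𝓡 4) ∞ P T →
    (∀ z, h₁ z ∈ T → G z = P (h₁ z)) →
    ∃ (W : Set X) (Ψs : X → Y), IsOpen W ∧ range h₁ ⊆ W ∧ ContMDiffOn (𝓡 4) (𝓡 4) ∞ Ψs W ∧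
      ∀ z, Ψs (h₁ z) = G z)

/-- **Registered helper stub `stub_seamDiffeosExtendToolkit`** of line `lp-by-sphere-system-surgery`
(ambient presentation toolkit of the seam diffeomorphisms `stub_seamDiffeos`). -/
theorem stub_seamDiffeosExtendToolkit : SeamDiffeosExtendToolkit :=
  ⟨fun _ _ _ _ _ _ _ _ _ _ _ _ hh₁ _ hG _ hz => exists_local_extension_interior hh₁ hG hz,
    fun _ _ _ _ _ _ _ _ _ _ _ _ _ _ _ _ _ _ _ hh₁ _ hG _ hT hbT _ hP hGP =>
      exists_seam_extension hh₁ hG hT hbT hP hGP⟩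

end Summit.SmoothPoincare4.SmoothPoincare4.Cruxes.AgkCor6Sufficiency.LpBySphereSystemSurgery

end
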